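import Mathlib
import Summits.QuantumFields.YangMills.Theses.SpecificationCompactness
import Summits.QuantumFields.YangMills.Theorems.SpecificationCompactnessCondExpDensityCalculus
import Summits.QuantumFields.YangMills.Theorems.SpecificationCompactnessCondExpDensityUI
import Summits.QuantumFields.YangMills.Theorems.SpecificationCompactnessHeightZeroDensityBridge
import Literature.MathematicalPhysics.QuantumFieldTheory.Balaban1983to89.T3OrbitAverage

/-!
# `AveragedSpecificationLimitM` (route SpecificationCompactness, support r9, stmt-QuantumFields-28301 — v2 of 28252 after critic
# VERDICT #116: convergence IN MEASURE) — PROVED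

For every torus family `F`, `γ > 0`, floor `δ > 0` and continuous fibre-normalised single-link profiles `q_e ≥ δ`
(`π₀[q_e | links ≠ e] = 1` a.e.): if the canonical single-link conditional densities of the renormalised unit laws converge
IN π₀-MEASURE, `ρ̂_K/π₀[ρ̂_K | links ≠ e] → q_e` (the C1 body, v2), and the normalised unit densities `ρ̂_K/∫ρ̂_K` are uniformly
integrable (the C2 body), then for every link `e` and every continuous `f`

  `∫ |ρ_K[f | links ≠ e] − π₀[q_e·f | links ≠ e]| dρ_K → 0`,

`ρ_K = unitLaw expMeanLogSU γ K = (ρ̂_K/∫ρ̂_K)·π₀` (tree `unitLaw_eq_withDensity_emlDensity`).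

THE ARGUMENT is fibre-free (helper files `…CondExpDensityCalculus`, `…CondExpDensityUI`): the Bayes bound
`∫ |ρ_K[f|MeasurableSpace.comap r MeasurableSpace.pi] − π₀[q f|MeasurableSpace.comap r MeasurableSpace.pi]| dρ_K ≤ ‖f‖∞ ∫ |ũ_K − π₀[ũ_K|MeasurableSpace.comap r MeasurableSpace.pi]·q| dπ₀` (test the `m`-measurable difference against its sign), and the
Scheffé–Vitali step `∫ |ũ_K − π₀[ũ_K|MeasurableSpace.comap r MeasurableSpace.pi]·q| dπ₀ → 0` (`= 2∫ π₀[ũ_K|MeasurableSpace.comap r MeasurableSpace.pi]·(q − ũ_K/π₀[ũ_K|MeasurableSpace.comap r MeasurableSpace.pi])₊`, uniformly integrable × bounded → 0 a.e.).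
This file only instantiates: `X₀ = SU(2)^{unit bonds}` compact (continuous `q_e`, `f` are bounded and Borel), `π₀` = product Haar
(probability), `m = σ(links ≠ e)` (a `comap`, `≤` the product σ-algebra), `ũ_K = (∫ρ̂_K)⁻¹ρ̂_K` (`∫ρ̂_K dπ₀ = Z_K`, bridge file
`…HeightZeroDensityBridge`).

HONEST FRAMING.  Measure theory only (rung R3 RECORD line): the cruxes `PointwiseSpecificationLimit` / `UnitDensityUI` are hypotheses here,
nothing is proved about them, about `ContinuumYM3Torus`, or about the YM mass gap.  Sources: [Georgii2011] Thm 4.17, [FriedliVelenik2017]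
Lemma 6.27 (the DLR limit pattern), [Balaban1985UV3] (2) p. 256 + (6) p. 257 (the unit laws `ρ_K dV/Z`).
-/

noncomputable section

namespace Summit.QuantumFields.YangMills.Theorems.SpecificationCompactnessKernel

open MeasureTheory Filter Topology
open Literature.MathematicalPhysics.QuantumFieldTheory.Balaban1983to89
open Literature.MathematicalPhysics.QuantumFieldTheory.Balaban1983to89.T3ContinuumYM3Torus
open Literature.MathematicalPhysics.QuantumFieldTheory.Balaban1983to89.Missing
open Literature.MathematicalPhysics.QuantumFieldTheory.Balaban1983to89.T4Continuum
open Literature.MathematicalPhysics.QuantumFieldTheory.Balaban1983to89.T3ThresholdRemoval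
open Literature.MathematicalPhysics.QuantumFieldTheory.Balaban1983to89.T3UnitLawDensityEML
open Literature.MathematicalPhysics.QuantumFieldTheory.Balaban1983to89.T3OrbitAverage

/-- `σ(links ≠ e) ≤` the product σ-algebra of the unit-torus configuration space `X₀ = SU(2)^{bonds of T₁}`. [folklore] -/
theorem linksNe_le (F : T3Family) (e : PBond (F.P 0) 0) :
    MeasurableSpace.comap (fun (W : GaugeField (F.P 0) 0 (Matrix.specialUnitaryGroup (Fin 2) ℂ))
        (b : {b : PBond (F.P 0) 0 // b ≠ e}) => W b.1) MeasurableSpace.pi ≤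
      (inferInstance : MeasurableSpace (GaugeField (F.P 0) 0 (Matrix.specialUnitaryGroup (Fin 2) ℂ))) :=
  Measurable.comap_le (measurable_pi_lambda _ fun b => measurable_pi_apply (b.1 : PBond (F.P 0) 0))

section InMeasure

variable {X : Type*} {m m0 : MeasurableSpace X} {π : Measure X}

/-- **SCHEFFÉ–VITALI WITHOUT FIBRES, IN-MEASURE VERSION**: as `tendsto_integral_abs_sub_condExp_mul` (helper file `…CondExpDensityUI`), with the
ratios `u_K/π[u_K|m] → q` converging only IN MEASURE — every subsequence has an a.e.-convergent sub-subsequence along which the a.e. version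
applies (uniform integrability is inherited by subsequences). [folklore] -/
theorem tendsto_integral_abs_sub_condExp_mul_of_tendstoInMeasure (hm : m ≤ m0) [IsProbabilityMeasure π]
    {u : ℕ → X → ℝ} (hu : ∀ K, Measurable (u K)) (hu0 : ∀ K x, 0 ≤ u K x) (hui : ∀ K, Integrable (u K) π)
    {q : X → ℝ} (hq : Measurable q) (hq0 : ∀ x, 0 ≤ q x) {Q : ℝ} (hqQ : ∀ x, q x ≤ Q)
    (hq1 : ∀ᵐ x ∂π, π[q|m] x = 1)
    (hlim : TendstoInMeasure π (fun K x => u K x / π[u K|m] x) atTop q)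
    (hUI : ∀ ε : ℝ, 0 < ε → ∃ (M : ℝ) (K₀ : ℕ), ∀ K, K₀ ≤ K → ∫ x, max (u K x - M) 0 ∂π ≤ ε) :
    Tendsto (fun K => ∫ x, |u K x - π[u K|m] x * q x| ∂π) atTop (𝓝 0) := by
  refine tendsto_of_subseq_tendsto fun ns hns => ?_
  have hlim' : TendstoInMeasure π (fun i x => u (ns i) x / π[u (ns i)|m] x) atTop q :=
    fun ε hε => (hlim ε hε).comp hns
  obtain ⟨ms, hms, hae⟩ := hlim'.exists_seq_tendsto_ae
  refine ⟨ms, ?_⟩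
  have hUI' : ∀ ε : ℝ, 0 < ε → ∃ (M : ℝ) (K₀ : ℕ), ∀ K, K₀ ≤ K → ∫ x, max (u (ns (ms K)) x - M) 0 ∂π ≤ ε := by
    intro ε hε
    obtain ⟨M, K₀, hM⟩ := hUI ε hε
    obtain ⟨K₁, hK₁⟩ := Filter.eventually_atTop.mp
      ((hns.comp hms.tendsto_atTop).eventually (Filter.eventually_ge_atTop K₀))
    exact ⟨M, K₁, fun K hK => hM _ (hK₁ K hK)⟩
  exact tendsto_integral_abs_sub_condExp_mul hm (fun K => hu _) (fun K => hu0 _) (fun K => hui _) hq hq0 hqQ hq1 hae hUI'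

end InMeasure

/-- **`AveragedSpecificationLimitM` (route SpecificationCompactness, support r9, stmt-QuantumFields-28301; v2 of 28252) HOLDS.**  Fibre-free
Bayes bound + Scheffé–Vitali (helper files) + the subsequence upgrade to in-measure convergence, instantiated on `X₀ = SU(2)^{unit bonds}` with
product Haar `π₀` and `ũ_K = (∫ρ̂_K)⁻¹ρ̂_K`.  Rung R3 RECORD line; no crux, no instance of `ContinuumYM3Torus` and nothing about the YM mass gap
is proved here. [cite: Georgii2011, Thm 4.17] -/
theorem averagedSpecificationLimitM_proof :
    Summit.QuantumFields.YangMills.Theses.SpecificationCompactness.AveragedSpecificationLimitM := by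
  intro F γ hγ δ q hq hlim hUI e f hf
  obtain ⟨hδ, hqc, hqδ, hq1⟩ := hq
  -- the setting
  set π₀ : Measure (GaugeField (F.P 0) 0 (Matrix.specialUnitaryGroup (Fin 2) ℂ)) :=
    fieldMeasure (F.P 0) 0 (Matrix.specialUnitaryGroup (Fin 2) ℂ) with hπ₀
  haveI : IsProbabilityMeasure π₀ := Missing.isProbabilityMeasure_fieldMeasure (F.P 0) 0
  -- the restriction to the links `≠ e` (NB: no local of class type `MeasurableSpace X₀` is introduced — it would shadow the instance)
  set r : GaugeField (F.P 0) 0 (Matrix.specialUnitaryGroup (Fin 2) ℂ) →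
      ({b : PBond (F.P 0) 0 // b ≠ e} → Matrix.specialUnitaryGroup (Fin 2) ℂ) := fun W b => W b.1 with hr
  have hm : MeasurableSpace.comap r MeasurableSpace.pi ≤
      (inferInstance : MeasurableSpace (GaugeField (F.P 0) 0 (Matrix.specialUnitaryGroup (Fin 2) ℂ))) :=
    linksNe_le F e
  -- bounds and measurability of `q e` and `f` (compactness of `X₀`)
  obtain ⟨Q, hQ⟩ := (isCompact_range (hqc e)).bddAbove
  have hqQ : ∀ x, q e x ≤ Q := fun x => hQ (Set.mem_range_self x)
  have hq0 : ∀ x, 0 ≤ q e x := fun x => hδ.le.trans (hqδ e x)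
  have hqabs : ∀ x, |q e x| ≤ Q := fun x => by rw [abs_of_nonneg (hq0 x)]; exact hqQ x
  have hqm : Measurable (q e) := (hqc e).measurable
  obtain ⟨B, hB⟩ := (isCompact_range (continuous_abs.comp hf)).bddAbove
  have hfB : ∀ x, |f x| ≤ B := fun x => hB (Set.mem_range_self (f := fun y => |f y|) x)
  have hfm : Measurable f := hf.measurable
  -- the normalised densities
  obtain hprops := fun K => unitDensity_props F K hγ.le
  set u : ℕ → GaugeField (F.P 0) 0 (Matrix.specialUnitaryGroup (Fin 2) ℂ) → ℝ :=
    fun K V => (∫ W, unitDensity F γ K W ∂π₀)⁻¹ * unitDensity F γ K V with hu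
  have hZ : ∀ K, 0 < ∫ W, unitDensity F γ K W ∂π₀ := fun K => by
    rw [hπ₀, integral_unitDensity F hγ.le K]; exact partitionFn_pos' _ (F.scheme_β_nonneg ℰp hγ.le K)
  have hum : ∀ K, Measurable (u K) := fun K => (hprops K).1.const_mul _
  have hu0 : ∀ K x, 0 ≤ u K x := fun K x => mul_nonneg (inv_nonneg.mpr (hZ K).le) ((hprops K).2.1 x)
  have hui : ∀ K, Integrable (u K) π₀ := fun K => (hprops K).2.2.const_mul _
  -- the unit laws are `ũ_K · π₀`
  have hρ : ∀ K, F.unitLaw (ExpMeanLog.expMeanLogSU : LoopAverage (Matrix.specialUnitaryGroup (Fin 2) ℂ))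
      T4ApexTwoLevel.measurableE_expMeanLogSU γ K = π₀.withDensity (fun V => ENNReal.ofReal (u K V)) := fun K => by
    have h := unitLaw_eq_withDensity_emlDensity F K hγ.le
    rw [← integral_unitDensity F hγ.le K] at h
    exact h
  -- the ratios do not see the normalisation
  have hlim' : TendstoInMeasure π₀ (fun K V => u K V / π₀[u K|MeasurableSpace.comap r MeasurableSpace.pi] V) atTop (q e) := by
    have hsm : ∀ K, π₀[u K|MeasurableSpace.comap r MeasurableSpace.pi] =ᵐ[π₀] fun V => (∫ W, unitDensity F γ K W ∂π₀)⁻¹ * π₀[unitDensity F γ K|MeasurableSpace.comap r MeasurableSpace.pi] V :=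
      fun K => by
        have h := condExp_smul (μ := π₀) ((∫ W, unitDensity F γ K W ∂π₀)⁻¹) (unitDensity F γ K) (MeasurableSpace.comap r MeasurableSpace.pi)
        have he : ((∫ W, unitDensity F γ K W ∂π₀)⁻¹ • unitDensity F γ K) = u K := by
          funext V; simp [hu, smul_eq_mul]
        rw [he] at h
        filter_upwards [h] with V hV
        rw [hV]; simp [smul_eq_mul]
    refine (hlim e).congr (fun K => ?_) EventuallyEq.rfl
    filter_upwards [hsm K] with V hV
    rw [hV]
    simp only [hu]
    rw [mul_div_mul_left _ _ (ne_of_gt (inv_pos.mpr (hZ K)))]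
  -- the two abstract steps
  have hC := tendsto_integral_abs_sub_condExp_mul_of_tendstoInMeasure (π := π₀) hm hum hu0 hui hqm hq0 hqQ (hq1 e) hlim' hUI
  have hBd : ∀ K, ∫ V, |(π₀.withDensity (fun V => ENNReal.ofReal (u K V)))[f|MeasurableSpace.comap r MeasurableSpace.pi] V - π₀[fun W => q e W * f W|MeasurableSpace.comap r MeasurableSpace.pi] V|
      ∂π₀.withDensity (fun V => ENNReal.ofReal (u K V)) ≤ B * ∫ V, |u K V - π₀[u K|MeasurableSpace.comap r MeasurableSpace.pi] V * q e V| ∂π₀ := fun K =>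
    integral_abs_condExp_sub_le hm (hum K) (hu0 K) (hui K) hfm hfB hqm hqabs
  simp only [hρ]
  refine squeeze_zero (fun K => integral_nonneg fun V => abs_nonneg _) hBd ?_
  simpa using hC.const_mul B

end Summit.QuantumFields.YangMills.Theorems.SpecificationCompactnessKernel

end
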